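import Mathlib.Analysis.InnerProductSpace.PiL2
import Mathlib.Analysis.SpecialFunctions.Trigonometric.Basic
import Literature.MathematicalPhysics.StatisticalMechanics.StickyWulffConstants
import HarnessLib

/-!
# Line `WallLedgerG` for the crux `GenericWallFloor` (stmt-Ventures-19480) — DEFINITIONS file

HONEST FRAMING. Part of the venture `Summits/Ventures/Crystal3D` (cell `crystal3d-full`), route
`route-Ventures-StickyWulffConstant`, crux `GenericWallFloor` (stmt-Ventures-19480).  This file carries,
VERBATIM, the two `Prop` definitions of the planner's REGISTERED skeleton
`HOME/cf-p1/route/lines/wall/WallLedgerG.lean` (planner crystal3d-full-p1 gen 16; `ledger skeleton check` OK;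
evidence on stmt-Ventures-19480) so that the registered stubs `stub_affineSampleDeficit : AffineSampleDeficit`
and `stub_twoSlabAdhesion : TwoSlabAdhesion` can be proved BY NAME in `Theorems/` files against exactly these
names.  Imports are route-independent (no `Theses` import); declarations unchanged.

The clamped-cylinder wall cell of `GenericWallFloor` is split exactly like the NRG line `adhesion`
(`stub_sampleDeficit` landed + `stub_adhesion`):

  `D(X) = D(P₁) + D(P₂) + D(Y) − cross(P₁, X \ P₁) − cross(P₂, (X \ P₁) \ P₂)`,  `Y = (X \ P₁) \ P₂`,

so the crux follows from

* `AffineSampleDeficit` (S/M, transport of the landed `Theorems.stub_sampleDeficit` to a moved lattice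
  `A·Λ₀ + t`, an off-centre disc and a height window `[a, b]`, `b − a = R`): the sample's own deficiency
  counts its two flat faces, `D(P) ≥ 2 φ(A⁻¹e₃) π ρ² − C ρ`;
* `TwoSlabAdhesion` (THE CRUX OF THE LINE): for a NON-co-axial pair, the filling's adhesion to the two
  clamped samples exceeds its own deficiency by at most `(φ₁ + φ₂ − 1) π ρ² + C (1 + h) ρ` (slot-ledger
  form of the wall floor; memo HOME/cf-p1/ROUTE.md §68).

The kernel-checked composition `GenericWallFloor_holds_of_stubs` stays in the planner's skeleton (it
imports the route file); it is landed as the closing file once both stubs are in the tree.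
WHAT THIS IS NOT: a proof of either stub; rung F-C1 not moved.
-/

noncomputable section

namespace Summit.Ventures.Crystal3D.Cruxes.GenericWallFloor.WallLedgerG

open Literature.MathematicalPhysics.StatisticalMechanics (fccStacking barlowStacking IsHaggSeq
  contactDeficiency)
open scoped InnerProductSpace

/-- **AffineSampleDeficit** (registered stub `stub_affineSampleDeficit`, S/M): the clamped slab sample
of a MOVED fcc lattice `A·Λ₀ + t` (height window `[a, b]` of thickness `b − a = R ≥ 1`, lateral disc of
radius `ρ` about the `e₃` axis) has contact deficiency at least its two flat faces,
`2 φ(A⁻¹ e₃) π ρ² − C ρ`, with `C` depending on `A, t, R` only.  Transport of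
`Theorems.stub_sampleDeficit` (landed, origin-centred, window `[−2R, −R]`, arbitrary unit normal)
through the rigid motion, plus the off-centre disc. -/
def AffineSampleDeficit : Prop :=
    ∀ (A : EuclideanSpace ℝ (Fin 3) ≃ₗᵢ[ℝ] EuclideanSpace ℝ (Fin 3)) (t : EuclideanSpace ℝ (Fin 3))
      (R : ℝ), 1 ≤ R → ∃ C : ℝ, ∀ a b : ℝ, b - a = R → ∀ ρ : ℝ, R ≤ ρ →
      ∀ P : Finset (EuclideanSpace ℝ (Fin 3)),
        (∀ p, p ∈ P ↔ (p ∈ (fun q => A q + t) '' fccStacking 1 (Real.sqrt (2 / 3)) ∧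
          a ≤ p 2 ∧ p 2 ≤ b ∧ p 0 ^ 2 + p 1 ^ 2 ≤ ρ ^ 2)) →
        2 * (Real.sqrt 2 / 4 * ∑ᶠ w ∈ {w ∈ fccStacking 1 (Real.sqrt (2 / 3)) | ‖w‖ = 1},
            |⟪w, A.symm (EuclideanSpace.single (2 : Fin 3) (1 : ℝ))⟫_ℝ|) * Real.pi * ρ ^ 2 - C * ρ ≤
          contactDeficiency P

/-- **TwoSlabAdhesion** (registered stub `stub_twoSlabAdhesion`, THE CRUX OF THE LINE): for a
NON-co-axial pair of fcc lattices `Λ₁ = A₁·Λ₀ + t₁`, `Λ₂ = A₂·Λ₀ + t₂` there are `C` and `R₀ ≥ 1` such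
that in every clamped cylinder cell (all balls in `[−2R₀, h + 2R₀] ×` disc `ρ`, the two slab samples
`P₁ ⊆ Λ₁` (`[−2R₀, −R₀]`) and `P₂ ⊆ Λ₂` (`[h + R₀, h + 2R₀]`) complete), the ADHESION EXCESS of the
filling `Y = (X \ P₁) \ P₂` is at most the two inner faces minus one unit of area:
`cross(P₁, X \ P₁) + cross(P₂, Y) ≤ D(Y) + (φ₁ + φ₂ − 1) π ρ² + C (1 + h) ρ`
(`φᵢ = φ(Aᵢ⁻¹ e₃)` inlined).  Ledger reading: unconsumed `Λ₁`-slots + unconsumed `Λ₂`-slots +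
interlayer deficiency `≥ 2 π ρ² − C(1+h)ρ`. -/
def TwoSlabAdhesion : Prop :=
    ∀ (A₁ : EuclideanSpace ℝ (Fin 3) ≃ₗᵢ[ℝ] EuclideanSpace ℝ (Fin 3)) (t₁ : EuclideanSpace ℝ (Fin 3))
      (A₂ : EuclideanSpace ℝ (Fin 3) ≃ₗᵢ[ℝ] EuclideanSpace ℝ (Fin 3)) (t₂ : EuclideanSpace ℝ (Fin 3)),
    ¬ (∃ (L : EuclideanSpace ℝ (Fin 3) ≃ₗᵢ[ℝ] EuclideanSpace ℝ (Fin 3))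
        (s₁ s₂ : EuclideanSpace ℝ (Fin 3)) (σ σ' : ℤ → ℤ), IsHaggSeq σ ∧ IsHaggSeq σ' ∧
        (fun p => A₁ p + t₁) '' fccStacking 1 (Real.sqrt (2 / 3)) ⊆
          (fun p => L p + s₁) '' barlowStacking 1 (Real.sqrt (2 / 3)) σ ∧
        (fun p => A₂ p + t₂) '' fccStacking 1 (Real.sqrt (2 / 3)) ⊆
          (fun p => L p + s₂) '' barlowStacking 1 (Real.sqrt (2 / 3)) σ') →
    ∃ C R₀ : ℝ, 1 ≤ R₀ ∧ ∀ h : ℝ, 0 ≤ h → ∀ ρ : ℝ, R₀ ≤ ρ →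
      ∀ X P₁ P₂ : Finset (EuclideanSpace ℝ (Fin 3)),
      (∀ p ∈ X, ∀ q ∈ X, p ≠ q → 1 ≤ dist p q) → P₁ ⊆ X → P₂ ⊆ X \ P₁ →
      (∀ p ∈ X, -(2 * R₀) ≤ p 2 ∧ p 2 ≤ h + 2 * R₀ ∧ p 0 ^ 2 + p 1 ^ 2 ≤ ρ ^ 2) →
      (∀ p, p ∈ P₁ ↔ (p ∈ (fun q => A₁ q + t₁) '' fccStacking 1 (Real.sqrt (2 / 3)) ∧
        -(2 * R₀) ≤ p 2 ∧ p 2 ≤ -R₀ ∧ p 0 ^ 2 + p 1 ^ 2 ≤ ρ ^ 2)) →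
      (∀ p, p ∈ P₂ ↔ (p ∈ (fun q => A₂ q + t₂) '' fccStacking 1 (Real.sqrt (2 / 3)) ∧
        h + R₀ ≤ p 2 ∧ p 2 ≤ h + 2 * R₀ ∧ p 0 ^ 2 + p 1 ^ 2 ≤ ρ ^ 2)) →
      ((((P₁ ×ˢ (X \ P₁)).filter fun pq => dist pq.1 pq.2 = 1).card : ℕ) : ℝ) +
        ((((P₂ ×ˢ ((X \ P₁) \ P₂)).filter fun pq => dist pq.1 pq.2 = 1).card : ℕ) : ℝ) ≤
        contactDeficiency ((X \ P₁) \ P₂) +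
          (Real.sqrt 2 / 4 * ∑ᶠ w ∈ {w ∈ fccStacking 1 (Real.sqrt (2 / 3)) | ‖w‖ = 1},
              |⟪w, A₁.symm (EuclideanSpace.single (2 : Fin 3) (1 : ℝ))⟫_ℝ| +
            Real.sqrt 2 / 4 * ∑ᶠ w ∈ {w ∈ fccStacking 1 (Real.sqrt (2 / 3)) | ‖w‖ = 1},
              |⟪w, A₂.symm (EuclideanSpace.single (2 : Fin 3) (1 : ℝ))⟫_ℝ| - 1) * Real.pi * ρ ^ 2 +
          C * (1 + h) * ρ

end Summit.Ventures.Crystal3D.Cruxes.GenericWallFloor.WallLedgerG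

end
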